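import Summits.HubbardSuperconductivity.HubbardSuperconductivity.Theorems.TwTipContinuation.Negative.TipNormalForm

/-!
# `TwTipContinuation` (stmt-HubbardSuperconductivity-1700), line `isogap-submodular-transport`,
# stub `stub_edgeOrder` — piece 1: the chord reduction

For the seeded family `H_L(0,g) = hubbardTorus 2 L 1 0 − (g/L²) P_L`,
`P_L = (pairField d L)ᴴ (pairField d L)`, the left chord at `g' = 0 < g = c`
(`leftChord_le_order`, Negative/SeededChords) pins the pair intensity of EVERY normalised sector
ground state `ψ` at seed `c` from below by the energy gain:
`E_L(0,0) − E_L(0,c) ≤ (c/L²) · re⟨ψ, P_L ψ⟩`. Hence an EXTENSIVE GAP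
`κ L² ≤ E_L(0,0) − E_L(0,c)` (eventually in even `L`) gives every-ground-state d-wave order
`(κ/c) L⁴ ≤ re⟨ψ, P_L ψ⟩` of the `U = 0` reduced d-wave BCS torus in the canonical sector.
This file proves exactly that reduction (`edgeOrder_of_extensiveGap`), on the literal route terms.
-/

noncomputable section

namespace Summit.HubbardSuperconductivity.TwTipContinuation.IsogapTransport

open Matrix Filter Finset
open Literature.MathematicalPhysics.QuantumLattice Literature.Probability.LatticeModels
open Summit.HubbardSuperconductivity.TwTipContinuation.Negative
open scoped ComplexOrder

/-- **Chord reduction at one side.** At a fixed side `L`, if the pure torus' sector energy exceeds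
the seeded one by `κ L²`, `κ L² ≤ E_L(0,0) − E_L(0,c)` (`c > 0`), then every normalised sector
ground state `ψ` of the seeded Hamiltonian at seed `c` has `(κ/c) L⁴ ≤ re⟨ψ, P_L ψ⟩`
(left chord `E_L(0,0) − E_L(0,c) ≤ (c/L²) re⟨ψ,P_Lψ⟩`). [folklore] -/
theorem order_of_gap_at {c κ : ℝ} (hc : 0 < c) {L : ℕ} [NeZero L] {n : ℕ}
    (hgap : κ * (L : ℝ) ^ 2 ≤
      (Matrix.minEnergyOn (hubbardTorus 2 L 1 0) (szSector (2 * n) 0))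
        - (Matrix.minEnergyOn (hubbardTorus 2 L 1 0 - ((c / (L : ℝ) ^ 2 : ℝ) : ℂ) • ((pairField dWaveFormFactor L)ᴴ * pairField dWaveFormFactor L)) (szSector (2 * n) 0)))
    {ψ : Fock (Orb (FermionTorus 2 L))} (hψ : star ψ ⬝ᵥ ψ = 1)
    (hgs : IsGroundStateInSector (hubbardTorus 2 L 1 0 - ((c / (L : ℝ) ^ 2 : ℝ) : ℂ) • ((pairField dWaveFormFactor L)ᴴ * pairField dWaveFormFactor L)) (2 * n) 0 ψ) :
    κ / c * (L : ℝ) ^ 4 ≤ (expect ((pairField dWaveFormFactor L)ᴴ * pairField dWaveFormFactor L) ψ).re := by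
  have hchord := leftChord_le_order (U := 0) (g := c) (g' := 0) (L := L) (n := n) hc hψ hgs
  rw [seededH_zero] at hchord
  have hL : (0 : ℝ) < (L : ℝ) ^ 2 := by
    have := NeZero.pos L
    positivity
  have key : κ * (L : ℝ) ^ 2 ≤
      (c - 0) / (L : ℝ) ^ 2 * (expect ((pairField dWaveFormFactor L)ᴴ * pairField dWaveFormFactor L) ψ).re :=
    hgap.trans hchord
  rw [sub_zero, div_mul_eq_mul_div, le_div_iff₀ hL] at key
  rw [div_mul_eq_mul_div, div_le_iff₀ hc]
  calc κ * (L : ℝ) ^ 4 = κ * (L : ℝ) ^ 2 * (L : ℝ) ^ 2 := by ring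
    _ ≤ c * (expect ((pairField dWaveFormFactor L)ᴴ * pairField dWaveFormFactor L) ψ).re := key
    _ = (expect ((pairField dWaveFormFactor L)ᴴ * pairField dWaveFormFactor L) ψ).re * c := mul_comm _ _

/-- **Chord reduction (piece 1 of `stub_edgeOrder`).** If, eventually in even `L`, the pure free
torus' sector energy in the canonical sector `(2⌊(1-δ)L²/2⌋, S^z = 0)` exceeds that of the
`U = 0` reduced d-wave BCS torus `hubbardTorus 2 L 1 0 − (c/L²)P_L` by an extensive amount
`κ L²` (`κ, c > 0`), then every normalised sector ground state of the latter is d-wave ordered: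
`μ L⁴ ≤ re⟨ψ, P_L ψ⟩` with `μ = κ/c`, eventually in even `L`. [folklore] -/
theorem edgeOrder_of_extensiveGap :
    ∀ (δ c : ℝ), 0 < c → (∃ κ : ℝ, 0 < κ ∧ ∃ L₀ : ℕ, ∀ (L : ℕ) [NeZero L], L₀ ≤ L → Even L → κ * (L : ℝ) ^ 2 ≤ (Matrix.minEnergyOn (hubbardTorus 2 L 1 0) (szSector (2 * ⌊(1 - δ) * (L : ℝ) ^ 2 / 2⌋₊) 0)) - (Matrix.minEnergyOn (hubbardTorus 2 L 1 0 - ((c / (L : ℝ) ^ 2 : ℝ) : ℂ) • ((pairField dWaveFormFactor L)ᴴ * pairField dWaveFormFactor L)) (szSector (2 * ⌊(1 - δ) * (L : ℝ) ^ 2 / 2⌋₊) 0))) → ∃ μ : ℝ, 0 < μ ∧ ∃ L₀ : ℕ, ∀ (L : ℕ) [NeZero L], L₀ ≤ L → Even L → ∀ ψ : Fock (Orb (FermionTorus 2 L)), star ψ ⬝ᵥ ψ = 1 → IsGroundStateInSector (hubbardTorus 2 L 1 0 - ((c / (L : ℝ) ^ 2 : ℝ) : ℂ) • ((pairField dWaveFormFactor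 L)ᴴ * pairField dWaveFormFactor L)) (2 * ⌊(1 - δ) * (L : ℝ) ^ 2 / 2⌋₊) 0 ψ → μ * (L : ℝ) ^ 4 ≤ (expect ((pairField dWaveFormFactor L)ᴴ * pairField dWaveFormFactor L) ψ).re := by
  intro δ c hc hgap
  obtain ⟨κ, hκ, L₀, hL₀⟩ := hgap
  exact ⟨κ / c, div_pos hκ hc, L₀, fun L _ hL hE ψ hψ hgs => order_of_gap_at hc (hL₀ L hL hE) hψ hgs⟩

end Summit.HubbardSuperconductivity.TwTipContinuation.IsogapTransport
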